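import Summits.QuantumFields.BalabanUV.T4Continuum.Support.NE7SliceGaugeFunctionSized
import Summits.QuantumFields.BalabanUV.T4Continuum.Support.NE3RightInverseSupLetters
import Summits.QuantumFields.BalabanUV.T4Continuum.Support.NE3CurlOfGaugeDir
import Summits.QuantumFields.BalabanUV.T4Continuum.Support.PeriodicChoice
import HarnessLib

/-!
# NE7SliceStepContraction — THE DEFECT OF THE NEXT STATE FROM THE ERROR FIELD, WITH THE CURVED SUP LETTER (L) DISPLAYED AS A HYPOTHESIS (memo ROAD-G100 §2.6, F3 second half):
# for an error field `E` with `dirIter E = gaugeDir_V j` (skew periodic, `‖E‖ ≤ e_E`, `‖curl_W E‖ ≤ c_E`, `‖j‖ ≤ e_c`) the spike-free split `E = Ỹ_E + gaugeDir W ζ_E` has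
# `sup‖Ỹ_E‖ ≤ 2KM·c_E + 8K(M²x)·(frameC·M·e_E + e_c)∕M + 16Kd(M²x)·e_E`, hence the new defect `δ¹ ≤ e_E + sup‖Ỹ_E‖` and the new mean defect `m¹ ≤ frameC·M·e_E + e_c` —
# both PROPORTIONAL TO THE ERROR; the absorption uses only `16Kd·(M²x) ≤ 1∕2`

Cell `pub-balaban`, rung (B)+1 sub-cell t4, lineage `b2b-balaban-t4-ne7-p1`, generation 100 (CRUX PROVER NE7 #1 = OWNER of BINDER row NE7).  Memo `t4/b2b-balaban-t4-ne7-p1-g100/ROAD-G100.md` §2.6: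
after one step the tangent part is `T¹ = Ỹ⁰ + E′` with `dirIter E′ = gaugeDir_V j_c` and the datum of the next split is `j_c` (`NE7SliceStepIdentities`); by additivity (`NE7SliceSplitUnique`) the next
defect is read off the split of `E′` ALONE.  THIS FILE sizes that split: the gauge function by the letter `NE7GaugeFunctionSupLetter.sup_le_of_bmeanIterW_le` (nested mean = `−(framePotW E − j)`,
gradient = `E − Ỹ_E`), the slice part by THE CURVED SUP LETTER (L) — displayed as the hypothesis `hLet` in exactly the shape the successor must prove (memo §4):
`∀ Y ∈ energyBlockLandauW L N (k+1) W, ∀ B, (∀ z μ ν, μ ≠ ν → ‖curlAt W Y z μ ν‖ ≤ B) → ∀ y κ, ‖Y y κ‖ ≤ K·L^{k+1}·B` — applied to `Ỹ_E`, whose curl is `curl_W E − curl_W(gaugeDir W ζ_E)`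
(`‖curl_W(gaugeDir W ζ)‖ ≤ 2x‖ζ‖`, `NE3CurlOfGaugeDir`), and the two bounds are disentangled by the absorption `16Kd·M²x ≤ 1∕2` (`M²x = ε`).
WHAT ([folklore]; 0 def, 0 sorry; (L) is a HYPOTHESIS here, not asserted).
§1 `exists_bond_max` (a periodic bond field attains its sup on the period box).
§2 **`split_error_sized`**: the split of `E` with ITS SIZES — `Ỹ_E ∈ 𝒯_E(W)`, `E = Ỹ_E + gaugeDir W ζ_E`, `bmeanIterW ζ_E = −(framePotW E − j)`, `‖framePotW E − j‖ ≤ frameC·M·e_E + e_c`,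
   `‖Ỹ_E‖ ≤ s_E := 2K·M·c_E + 8K·(M²x)·(frameC·M·e_E + e_c)∕M + 16Kd·(M²x)·e_E`, `‖gaugeDir W ζ_E‖ ≤ e_E + s_E`, `‖ζ_E‖ ≤ 2((frameC·M·e_E + e_c) + 2dM(e_E + s_E))`.
HONEST FRAMING (page 1): CONDITIONAL on the displayed letter (L) (memo §4, NOT proved); linear bookkeeping otherwise; NOT (S1), NOT NE7; spine 0∕9; finite T⁴ rung (B)+1 — NOT infinite volume, NOT mass gap,
NOT BetaPertH, NOT Clay.  Continuum YM on T⁴ ⇐ BetaPertH ∧ nine spine estimates (0/9 proved); BetaPertH ⇐ (D1) ∧ (D4) ∧ CAP+tail; G-an2-4 gates asym, D1 and NE2/3/4.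
-/

set_option autoImplicit false

open scoped BigOperators Matrix.Norms.L2Operator
open Finset

namespace Summit.QuantumFields.BalabanUV.T4Continuum.NE7SliceStepContraction

open Literature.MathematicalPhysics.QuantumFieldTheory.Balaban1983to89
open B7Prop1Explicit B7Prop2Explicit
open T4AveragingDeficitWall (IsUnitaryCfg IsSkewDir SmallField Ad curlAt)
open T4AveragingDeficitWallBoundary (IsPeriodicCfg periodBox)
open AveragingDeficitPeriodicCounting (IsPeriodicDir)
open AveragingDeficitTwoLevelPrep (prop1Radius)
open AveragingDeficitMultiLevelPrep (cavgIter LevelSmall tower)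
open BlockAveragePushDirGauge (gaugeDir)
open NE3TangentCovariantTower (dirIter framePotW)
open NE3CovariantBlockMean (bmeanIterW)
open NE3RightInverseSupLetters (frameC norm_framePotW_le_of_sup)
open NE3CurlOfGaugeDir (norm_curlAt_gaugeDir_le curlAt_sub)
open NE7MeanZeroGaugeSliceW (energyBlockLandauW)
open NE7SliceGaugeFunctionSized (exists_fullGauge_split_sized)
open NE7GaugeFunctionSupLetter (sup_le_of_bmeanIterW_le)
open SpreadLift (loopRad)
open PeriodicChoice (apply_wrap_eq wrap_mem_periodBox)

noncomputable section

variable {d : ℕ} {n : Type*} [Fintype n] [DecidableEq n]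

/-! ## §1 A periodic bond field attains its sup -/

/-- a `P`-periodic bond field (`P ≥ 1`, `d ≥ 1`) attains its sup norm on the period box. [folklore] -/
theorem exists_bond_max (hd : 0 < d) {Y : Site d → Fin d → Matrix n n ℂ} {P : ℕ} (hP : 1 ≤ P) (hYP : IsPeriodicDir Y (P : ℤ)) :
    ∃ (y₀ : Site d) (μ₀ : Fin d), ∀ (y : Site d) (μ : Fin d), ‖Y y μ‖ ≤ ‖Y y₀ μ₀‖ := by
  have hne : ((periodBox (d := d) P) ×ˢ (univ : Finset (Fin d))).Nonempty :=
    ⟨⟨_, ⟨0, hd⟩⟩, Finset.mem_product.mpr ⟨wrap_mem_periodBox P hP 0, Finset.mem_univ _⟩⟩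
  obtain ⟨p₀, -, hp₀⟩ := Finset.exists_max_image _ (fun p : Site d × Fin d => ‖Y p.1 p.2‖) hne
  refine ⟨p₀.1, p₀.2, fun y μ => ?_⟩
  have hw := apply_wrap_eq (g := fun w => Y w μ) (fun z κ => hYP z κ μ) y
  rw [← hw]
  exact hp₀ ⟨fun κ => y κ % (P : ℤ), μ⟩ (Finset.mem_product.mpr ⟨wrap_mem_periodBox P hP y, Finset.mem_univ _⟩)

/-! ## §2 The split of the error field, sized (with (L) displayed) -/

/-- **THE SPLIT OF THE ERROR FIELD WITH ITS SIZES** (multi-level small-field class at level `k+1`, `2 ≤ L`, `d ≥ 1`, `W` unitary `(tower L N (k+1))`-periodic with `SmallField W x`, Poincaré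
parameter `θ_P ≤ 1∕2`, absorption `16Kd·(M²x) ≤ 1∕2`, and THE CURVED SUP LETTER (L) with constant `K ≥ 0` as the hypothesis `hLet`): for a skew periodic `E` with `dirIter E = gaugeDir_V j`
(`j` skew `N`-periodic), `‖E‖ ≤ e_E`, `‖curlAt W E‖ ≤ c_E` off the diagonal, `‖j‖ ≤ e_c`, there are `ζ` (skew periodic) and `Ỹ ∈ energyBlockLandauW L N (k+1) W` with `E = Ỹ + gaugeDir W ζ`,
`bmeanIterW ζ = −(framePotW E − j)`, and the sizes displayed in the statement (`M = L^{k+1}`). [folklore] -/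
theorem split_error_sized [Nonempty n] (hd : 0 < d) {L N : ℕ} [NeZero N] (hL : 2 ≤ L) (k : ℕ)
    {W : Site d → Fin d → (Matrix n n ℂ)ˣ} {x : ℝ} (hWu : IsUnitaryCfg W) (hWP : IsPeriodicCfg W ((tower L N (k + 1) : ℕ) : ℤ))
    (hx : 0 ≤ x) (hs : LevelSmall d L k x) (hWx : SmallField W x)
    (hθP : 4 * (d : ℝ) ^ 2 * ((L : ℝ) ^ (k + 1) - 1) ^ 2 * x + 16 * d * loopRad d L ((prop1Radius d L)^[k] x)
        + 4 * d * ((d : ℝ) - 1) * ((L : ℝ) ^ (k + 1) - 1) ^ 2 * x ≤ 1 / 2)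
    {K : ℝ} (hK : 0 ≤ K) (hKε : 16 * K * d * (((L : ℝ) ^ (k + 1)) ^ 2 * x) ≤ 1 / 2)
    (hLet : ∀ Y : Site d → Fin d → Matrix n n ℂ, Y ∈ energyBlockLandauW (d := d) (n := n) L N (k + 1) W →
      ∀ B : ℝ, (∀ (z : Site d) (μ ν : Fin d), μ ≠ ν → ‖curlAt W Y z μ ν‖ ≤ B) → ∀ (y : Site d) (κ : Fin d), ‖Y y κ‖ ≤ K * (L : ℝ) ^ (k + 1) * B)
    {E : Site d → Fin d → Matrix n n ℂ} (hEs : IsSkewDir E) (hEP : IsPeriodicDir E ((tower L N (k + 1) : ℕ) : ℤ))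
    {j : Site d → Matrix n n ℂ} (hjs : ∀ z, j z ∈ skewAdjoint (Matrix n n ℂ)) (hjP : ∀ (z : Site d) (i : Fin d), j (z + (N : ℤ) • e i) = j z)
    (hdir : dirIter L (k + 1) W E = gaugeDir (cavgIter L (k + 1) W) j)
    {eE cE ec : ℝ} (heE0 : 0 ≤ eE) (hcE0 : 0 ≤ cE)
    (hE : ∀ y κ, ‖E y κ‖ ≤ eE) (hcE : ∀ (z : Site d) (μ ν : Fin d), μ ≠ ν → ‖curlAt W E z μ ν‖ ≤ cE) (hj : ∀ z, ‖j z‖ ≤ ec) :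
    ∃ (ζ : Site d → Matrix n n ℂ) (YE : Site d → Fin d → Matrix n n ℂ),
      (∀ y, ζ y ∈ skewAdjoint (Matrix n n ℂ)) ∧ (∀ (y : Site d) (i : Fin d), ζ (y + ((tower L N (k + 1) : ℕ) : ℤ) • e i) = ζ y) ∧
      YE ∈ energyBlockLandauW (d := d) (n := n) L N (k + 1) W ∧
      (∀ y μ, E y μ = YE y μ + gaugeDir W ζ y μ) ∧
      (∀ z, bmeanIterW L (k + 1) W ζ z = -(framePotW L (k + 1) W E z - j z)) ∧
      (∀ z, ‖framePotW L (k + 1) W E z - j z‖ ≤ frameC d L * (L : ℝ) ^ (k + 1) * eE + ec) ∧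
      (∀ y μ, ‖YE y μ‖ ≤ 2 * K * (L : ℝ) ^ (k + 1) * cE + 8 * K * (((L : ℝ) ^ (k + 1)) ^ 2 * x) * (frameC d L * (L : ℝ) ^ (k + 1) * eE + ec) / (L : ℝ) ^ (k + 1)
          + 16 * K * d * (((L : ℝ) ^ (k + 1)) ^ 2 * x) * eE) ∧
      (∀ y μ, ‖gaugeDir W ζ y μ‖ ≤ eE + (2 * K * (L : ℝ) ^ (k + 1) * cE + 8 * K * (((L : ℝ) ^ (k + 1)) ^ 2 * x) * (frameC d L * (L : ℝ) ^ (k + 1) * eE + ec) / (L : ℝ) ^ (k + 1)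
          + 16 * K * d * (((L : ℝ) ^ (k + 1)) ^ 2 * x) * eE)) ∧
      (∀ y, ‖ζ y‖ ≤ 2 * ((frameC d L * (L : ℝ) ^ (k + 1) * eE + ec) + 2 * d * (L : ℝ) ^ (k + 1) *
          (eE + (2 * K * (L : ℝ) ^ (k + 1) * cE + 8 * K * (((L : ℝ) ^ (k + 1)) ^ 2 * x) * (frameC d L * (L : ℝ) ^ (k + 1) * eE + ec) / (L : ℝ) ^ (k + 1)
            + 16 * K * d * (((L : ℝ) ^ (k + 1)) ^ 2 * x) * eE)))) := by
  haveI : NeZero L := ⟨by omega⟩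
  have hL1 : 1 ≤ L := by omega
  have hP1 : 1 ≤ tower L N (k + 1) := Nat.one_le_iff_ne_zero.mpr (NeZero.ne _)
  set M : ℝ := (L : ℝ) ^ (k + 1) with hM
  have hM1 : 1 ≤ M := by
    have : (1 : ℝ) ≤ L := by exact_mod_cast hL1
    exact one_le_pow₀ this
  have hM0 : 0 < M := by linarith
  have hd1 : (1 : ℝ) ≤ d := by exact_mod_cast hd
  -- the split
  obtain ⟨ζ, YE, hζs, hζP, hYE, hsplit, hmean, -⟩ := exists_fullGauge_split_sized hL k hWu hWP hx hs hWx hEs hEP hjs hjP hdir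
  -- the mean defect
  set mE : ℝ := frameC d L * M * eE + ec with hmE
  have hmEb : ∀ z, ‖framePotW L (k + 1) W E z - j z‖ ≤ mE := fun z =>
    (norm_sub_le _ _).trans (add_le_add (norm_framePotW_le_of_sup hL k hWu hx hs hWx E heE0 hE z) (hj z))
  have hmE0 : 0 ≤ mE := (norm_nonneg _).trans (hmEb 0)
  -- the attained sup of the slice part
  obtain ⟨y₀, μ₀, hS⟩ := exists_bond_max hd hP1 hYE.2.1
  set S : ℝ := ‖YE y₀ μ₀‖ with hSdef
  have hS0 : 0 ≤ S := norm_nonneg _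
  -- the gradient of the gauge function is the defect `E − Ỹ_E`
  have hG : ∀ y μ, ‖gaugeDir W ζ y μ‖ ≤ eE + S := fun y μ => by
    have e1 : gaugeDir W ζ y μ = E y μ - YE y μ := by rw [hsplit y μ]; abel
    rw [e1]
    exact (norm_sub_le _ _).trans (add_le_add (hE y μ) (hS y μ))
  -- the size of the gauge function
  have hmζ : ∀ z, ‖bmeanIterW L (k + 1) W ζ z‖ ≤ mE := fun z => by rw [hmean z, norm_neg]; exact hmEb z
  have hθ1 : 4 * (d : ℝ) ^ 2 * ((L : ℝ) ^ (k + 1) - 1) ^ 2 * x + 16 * d * loopRad d L ((prop1Radius d L)^[k] x)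
      + 4 * d * ((d : ℝ) - 1) * ((L : ℝ) ^ (k + 1) - 1) ^ 2 * x < 1 := lt_of_le_of_lt hθP (by norm_num)
  have hσ : ∀ y, ‖ζ y‖ ≤ 2 * (mE + 2 * d * M * (eE + S)) := by
    intro y
    have h := sup_le_of_bmeanIterW_le hL k hWu hx hs hWx ζ hmζ hP1 hζP hG hθ1 y
    refine h.trans ?_
    rw [div_le_iff₀ (by linarith)]
    have hnum : mE + 2 * d * ((L : ℝ) ^ (k + 1) - 1) * (eE + S) ≤ mE + 2 * d * M * (eE + S) := by
      have : 2 * (d : ℝ) * ((L : ℝ) ^ (k + 1) - 1) * (eE + S) ≤ 2 * d * M * (eE + S) := by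
        have h0 : 0 ≤ eE + S := by positivity
        have h1 : ((L : ℝ) ^ (k + 1) - 1) ≤ M := by rw [hM]; linarith
        have h2 : 0 ≤ 2 * (d : ℝ) := by positivity
        nlinarith [mul_nonneg h2 h0]
      linarith
    have hpos : 0 ≤ mE + 2 * d * M * (eE + S) := by positivity
    nlinarith
  set σb : ℝ := 2 * (mE + 2 * d * M * (eE + S)) with hσb
  have hσb0 : 0 ≤ σb := by positivity
  -- the curl of the slice part
  have hYEfun : YE = fun y κ => E y κ - gaugeDir W ζ y κ := funext fun y => funext fun κ => by rw [hsplit y κ]; abel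
  have hcurl : ∀ (z : Site d) (μ ν : Fin d), μ ≠ ν → ‖curlAt W YE z μ ν‖ ≤ cE + 2 * x * σb := by
    intro z μ ν hμν
    rw [hYEfun, curlAt_sub]
    refine (norm_sub_le _ _).trans (add_le_add (hcE z μ ν hμν) ?_)
    exact (norm_curlAt_gaugeDir_le hWu hWx ζ z hμν).trans (mul_le_mul_of_nonneg_left (hσ z) (by positivity))
  -- THE LETTER, at the bond where the sup is attained; absorption
  have hLS : S ≤ K * M * (cE + 2 * x * σb) := hLet YE hYE _ hcurl y₀ μ₀
  have hb : 8 * K * d * (M ^ 2 * x) ≤ 1 / 4 := by nlinarith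
  have hkey : S ≤ K * M * cE + 4 * K * (M ^ 2 * x) * mE / M + 8 * K * d * (M ^ 2 * x) * eE + 8 * K * d * (M ^ 2 * x) * S := by
    have e : K * M * (cE + 2 * x * σb) = K * M * cE + 4 * K * (M ^ 2 * x) * mE / M + 8 * K * d * (M ^ 2 * x) * eE + 8 * K * d * (M ^ 2 * x) * S := by
      rw [hσb]; field_simp; ring
    linarith
  have ha0 : 0 ≤ K * M * cE + 4 * K * (M ^ 2 * x) * mE / M + 8 * K * d * (M ^ 2 * x) * eE := by positivity
  have hSb : S ≤ 2 * K * M * cE + 8 * K * (M ^ 2 * x) * mE / M + 16 * K * d * (M ^ 2 * x) * eE := by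
    have hbS : 8 * K * d * (M ^ 2 * x) * S ≤ 1 / 4 * S := mul_le_mul_of_nonneg_right hb hS0
    have hA : S ≤ (K * M * cE + 4 * K * (M ^ 2 * x) * mE / M + 8 * K * d * (M ^ 2 * x) * eE) + 1 / 4 * S := by linarith
    have h2 : S ≤ 2 * (K * M * cE + 4 * K * (M ^ 2 * x) * mE / M + 8 * K * d * (M ^ 2 * x) * eE) := by linarith
    have e : 2 * (K * M * cE + 4 * K * (M ^ 2 * x) * mE / M + 8 * K * d * (M ^ 2 * x) * eE)
        = 2 * K * M * cE + 8 * K * (M ^ 2 * x) * mE / M + 16 * K * d * (M ^ 2 * x) * eE := by ring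
    exact h2.trans (le_of_eq e)
  set sE : ℝ := 2 * K * M * cE + 8 * K * (M ^ 2 * x) * mE / M + 16 * K * d * (M ^ 2 * x) * eE with hsE
  refine ⟨ζ, YE, hζs, hζP, hYE, hsplit, hmean, hmEb, fun y μ => (hS y μ).trans hSb, fun y μ => (hG y μ).trans (by linarith), fun y => (hσ y).trans ?_⟩
  have : 2 * (d : ℝ) * M * (eE + S) ≤ 2 * d * M * (eE + sE) := by
    have h2 : 0 ≤ 2 * (d : ℝ) * M := by positivity
    nlinarith
  linarith

end

end Summit.QuantumFields.BalabanUV.T4Continuum.NE7SliceStepContraction
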